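import Summits.QuantumFields.BalabanUV.Beta.EriceRemainderEnclosureHistoryAutonomyComparisonBarrier

/-!
# EriceRemainderEnclosureHistoryAutonomyComparisonBarrierFlow — (E61d) THE ACCELERATED FLOW: the `B′`-flow driven along the base family,
# `1∕k_{m+1}² = 1∕k_m² + B′(S k_{m+1})`, `k_0 = y`, EXISTS from every pin (intermediate values: `z ↦ B′(S z)` is continuous on ]0,γ]), is the
# HIGHEST barrier of (E61a) (every super-solution lies below it, every sub-solution above it), and so the barrier principle is EXACTLY the statement
# «order of the effective β-functions at every pin ⟸ `B (S y) ≤ B′ k` for the accelerated flow `k` from every pin `y`» (`effective_le_all_of_accelerated`)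

Cell `pub-balaban`, β-function sub-cell, BINDER row D4 «RemainderConst leaves for Bałaban's split» (`HOME/BINDER-OWNERS.md`; owner lineage `b2b-balaban-beta-an4`;
this file by co-owner #2 lineage `b2b-balaban-beta-d4-p2`, generation 54), β-FLOW TEAM duty (1), FREEZE (0) honoured (def-free; (E48a)'s `tendsto_family` ∕
`family_zero` ∕ `family_mem` ∕ `strictMonoOn_scale` ∕ `le_upper_of_zm`, (E61a)'s `le_of_invSq_le` ∕ `barrier_le` ∕ `effective_le_all_of_barrier`, Mathlib's
`intermediate_value_Icc'` BY NAME; nothing restated).  Sequel of (E61a) `…ComparisonBarrier`; numerics of the accelerated flow (`T ≈ 0.86·Q∕2`, the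
`{1, 65536}` tower with `Q∕2 = 1.025 > 1` but `T = 0.88`) in `HOME/b2b-balaban-beta-d4-p2/g54/e61/README.md`.

HONEST FRAMING (page 1, verbatim and binding).  *"Discharging BetaPertH makes Bałaban's UV stability UNCONDITIONAL — a real constructive-QFT result; it is
NOT the continuum limit and NOT the Clay problem."*  THIS FILE DISCHARGES NOTHING OF THE KIND.  Elementary real analysis about ABSTRACT functionals on a box
]0,γ]^ℕ with displayed floors, moduli and signs — hypotheses of a census, not facts; the form, signs and moments of Bałaban's (1.22) limit functional are NOT
PRINTED ([I] p. 298; GAPS G-t4-U2-1∕-2) and NOT asserted.  Row D4 class UNCHANGED (critical-path width 0; instance 0∕1; D4 DISCHARGE NO DATE).  HONEST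
DEPENDENCY: continuum YM on T⁴ ⇐ BetaPertH ∧ nine spine estimates (0/9 proved); BetaPertH ⇐ (D1) ∧ (D4) ∧ CAP+tail; G-an2-4 gates asym, D1 and NE2/3/4.

THE POINT (census sense (α); the COMPARISON column of the autonomy row).  (E61a) proved THE STEP from any ONE barrier per pin — a box super-solution `k`
of «the `B′`-flow driven along the base family» with payoff `B(S y) ≤ B′ k` — and used the crudest one, the delayed base trajectory.  Here the barrier
principle is closed canonically.  §1: `z ↦ B′(S z)` is CONTINUOUS on ]0,γ] for every functional `B′` with a zeroth moment, by (E48a)'s continuity of the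
family uniformly in the age.  §2: hence the implicit one-step equation `1∕x² = 1∕z² + B′(S x)` has a solution `x ∈ ]0, z]` below every pin (intermediate
values between `x_lo = (1∕z² + U)^{−1∕2}`, `U` the box bound of `B′`, and `z`), and iterating, THE ACCELERATED FLOW EXISTS from every pin
(`exists_accelerated`).  §3: every sub-solution lies above every super-solution from the same pin (`super_le_sub`, the induction of (E61a) `barrier_le`
verbatim) — so the accelerated flow is the HIGHEST barrier and lies below the perturbed trajectory; its payoff is the weakest of all barrier payoffs
(`payoff_accelerated_of_barrier`).  §4: **`effective_le_all_of_accelerated`** — order of the effective β-functions at every pin (hence comparison at any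
size) follows from `B(S y) ≤ B′ k` for the accelerated flows alone: THE STEP, a statement about a PAIR of implicit flows with memory, is reduced to ONE
explicit recursion driven by the base family.  Numerically (README) this recursion proves the step exactly when the damped kernel mass `T` is `≤ 1`
(`T ≈ 0.86·Q∕2`), which is also the provable ceiling of every barrier ∕ certificate method.  NOT CLAIMED: uniqueness of the accelerated flow (not needed);
any new trajectory-free class; anything printed.

WHAT IS PROVED ([folklore]; 0 `def`, 0 sorry).  §1 **`continuousOn_effective`**.  §2 `exists_accelerated_step`, **`exists_accelerated`**.  §3 **`super_le_sub`**,
`barrier_le_accelerated`, `payoff_accelerated_of_barrier`.  §4 **`effective_le_all_of_accelerated`**.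
-/
noncomputable section
open Filter Topology Finset Set

namespace Summit.QuantumFields.BalabanUV.Beta.EriceRemainderEnclosureHistoryAutonomyComparisonBarrierFlow

open Literature.MathematicalPhysics.QuantumFieldTheory.Balaban1983to89
open Literature.MathematicalPhysics.QuantumFieldTheory.Balaban1983to89.T4BetaStationary
open Literature.MathematicalPhysics.QuantumFieldTheory.Balaban1983to89.T4BetaFlowWellPosed
open Summit.QuantumFields.BalabanUV.Beta.EriceRemainderEnclosureHistoryAutonomyOrder
open Summit.QuantumFields.BalabanUV.Beta.EriceRemainderEnclosureHistoryAutonomyComparisonBarrier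
  (le_of_invSq_le barrier_le effective_le_all_of_barrier)

variable {B B' : (ℕ → ℝ) → ℝ} {M M' γ b y : ℝ} {S S' : ℝ → ℕ → ℝ}

/-! ## §1 The memory term read along the base family is continuous in the pin -/

/-- **`z ↦ B′(S z)` IS CONTINUOUS ON ]0,γ]** for the (unique) solution family `S` of a functional `B` with floor `b > 0` and zeroth moment `M ≥ 0`, and
ANY functional `B′` with a zeroth moment `M′ ≥ 0` on the box: pins `g_n → p` give `sup_j |S(g_n) j − S p j| → 0` ((E48a) `tendsto_family`), hence
`|B′(S g_n) − B′(S p)| ≤ M′·sup_j |…| → 0`. [folklore] -/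
theorem continuousOn_effective (hb : 0 < b) (hγ : 0 < γ)
    (hB : ∀ u u' : ℕ → ℝ, SeqBox γ u → SeqBox γ u' → ∀ D : ℝ, (∀ j, |u j - u' j| ≤ D) → |B u - B u'| ≤ M * D)
    (hM : 0 ≤ M) (hlo : ∀ u, SeqBox γ u → b ≤ B u)
    (hS : ∀ p, 0 < p → p ≤ γ → SeqBox γ (S p) ∧ MemFlow B p (S p))
    (huniq : ∀ p, 0 < p → p ≤ γ → ∀ u u' : ℕ → ℝ, SeqBox γ u → SeqBox γ u' → MemFlow B p u → MemFlow B p u' → u = u')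
    (hB' : ∀ u u' : ℕ → ℝ, SeqBox γ u → SeqBox γ u' → ∀ D : ℝ, (∀ j, |u j - u' j| ≤ D) → |B' u - B' u'| ≤ M' * D) (hM' : 0 ≤ M') :
    ContinuousOn (fun p => B' (S p)) (Ioc 0 γ) := by
  intro p hp
  rw [ContinuousWithinAt, tendsto_iff_seq_tendsto]
  intro g hg
  rw [tendsto_nhdsWithin_iff] at hg
  set g' : ℕ → ℝ := fun n => if p / 2 ≤ g n ∧ g n ≤ γ then g n else p with hg'
  have hgb : ∀ n, p / 2 ≤ g' n ∧ g' n ≤ γ := by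
    intro n
    by_cases hc : p / 2 ≤ g n ∧ g n ≤ γ
    · simp only [hg', hc, and_self, if_true]
    · simp only [hg', hc, if_false]; exact ⟨by linarith [hp.1], hp.2⟩
  have hgn : ∀ n, 0 < g' n ∧ g' n ≤ γ := fun n => ⟨(half_pos hp.1).trans_le (hgb n).1, (hgb n).2⟩
  have hev : ∀ᶠ n in atTop, g' n = g n := by
    have h1 : ∀ᶠ n in atTop, p / 2 < g n := (tendsto_order.1 hg.1).1 _ (by linarith [hp.1])
    filter_upwards [h1, hg.2] with n hn1 hn2
    simp only [hg', hn1.le, hn2.2, and_self, if_true]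
  have hg't : Tendsto g' atTop (𝓝 p) := hg.1.congr' (hev.mono fun n hn => hn.symm)
  have hunif := (tendsto_family hb hγ hB hM hlo hS huniq hp hgb hg't).2
  -- the values B′(S g′_n) converge to B′(S p)
  have hlim : Tendsto (fun n => B' (S (g' n))) atTop (𝓝 (B' (S p))) := by
    rw [Metric.tendsto_atTop]
    intro ε hε
    have hε' : 0 < ε / (M' + 1) := div_pos hε (by linarith)
    obtain ⟨N, hN⟩ := eventually_atTop.1 (hunif (ε / (M' + 1)) hε')
    refine ⟨N, fun n hn => ?_⟩
    have h1 : |B' (S (g' n)) - B' (S p)| ≤ M' * (ε / (M' + 1)) :=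
      hB' _ _ (hS _ (hgn n).1 (hgn n).2).1 (hS p hp.1 hp.2).1 _ (hN n hn)
    have h2 : M' * (ε / (M' + 1)) < ε := by
      have hM1 : (0 : ℝ) < M' + 1 := by linarith
      rw [show M' * (ε / (M' + 1)) = M' * ε / (M' + 1) by ring, div_lt_iff₀ hM1]
      nlinarith
    rw [Real.dist_eq]
    exact lt_of_le_of_lt h1 h2
  refine hlim.congr' ?_
  filter_upwards [hev] with n hn
  simp only [Function.comp, hn]

/-! ## §2 The accelerated flow exists from every pin -/

/-- **ONE STEP OF THE ACCELERATED FLOW**: for every pin `z ∈ ]0,γ]` there is `x ∈ ]0, z]` with `1∕x² = 1∕z² + B′(S x)` (`B′` with floor `b > 0` and a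
zeroth moment; intermediate values of the continuous `x ↦ 1∕x² − B′(S x)` between `x_lo = (1∕z² + U)^{−1∕2}`, `U = B′(γ,γ,…) + M′γ`, where it is
`≥ 1∕z²`, and `z`, where it is `< 1∕z²`). [folklore] -/
theorem exists_accelerated_step (hb : 0 < b) (hγ : 0 < γ)
    (hB : ∀ u u' : ℕ → ℝ, SeqBox γ u → SeqBox γ u' → ∀ D : ℝ, (∀ j, |u j - u' j| ≤ D) → |B u - B u'| ≤ M * D)
    (hM : 0 ≤ M) (hlo : ∀ u, SeqBox γ u → b ≤ B u)
    (hS : ∀ p, 0 < p → p ≤ γ → SeqBox γ (S p) ∧ MemFlow B p (S p))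
    (huniq : ∀ p, 0 < p → p ≤ γ → ∀ u u' : ℕ → ℝ, SeqBox γ u → SeqBox γ u' → MemFlow B p u → MemFlow B p u' → u = u')
    (hB' : ∀ u u' : ℕ → ℝ, SeqBox γ u → SeqBox γ u' → ∀ D : ℝ, (∀ j, |u j - u' j| ≤ D) → |B' u - B' u'| ≤ M' * D) (hM' : 0 ≤ M')
    (hlo' : ∀ u, SeqBox γ u → b ≤ B' u) {z : ℝ} (hz : 0 < z) (hzγ : z ≤ γ) :
    ∃ x : ℝ, 0 < x ∧ x ≤ z ∧ 1 / x ^ 2 = 1 / z ^ 2 + B' (S x) := by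
  set U : ℝ := B' (fun _ => γ) + M' * γ with hU
  have hUge : ∀ u, SeqBox γ u → B' u ≤ U := le_upper_of_zm hB' hγ
  have hU0 : 0 < U := hb.trans_le ((hlo' _ (hS z hz hzγ).1).trans (hUge _ (hS z hz hzγ).1))
  have hq : 0 < 1 / z ^ 2 + U := by positivity
  set xlo : ℝ := 1 / Real.sqrt (1 / z ^ 2 + U) with hxlo
  have hxlo0 : 0 < xlo := one_div_pos.mpr (Real.sqrt_pos.mpr hq)
  have hxlo2 : 1 / xlo ^ 2 = 1 / z ^ 2 + U := by
    rw [hxlo, div_pow, one_pow, Real.sq_sqrt hq.le, one_div_one_div]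
  have hxloz : xlo ≤ z := le_of_invSq_le hz (by rw [hxlo2]; linarith)
  -- the function 1/x² − B′(S x) is continuous on [x_lo, z] ⊆ ]0,γ]
  set f : ℝ → ℝ := fun x => 1 / x ^ 2 - B' (S x) with hf
  have hsub : Icc xlo z ⊆ Ioc 0 γ := fun x hx => ⟨hxlo0.trans_le hx.1, hx.2.trans hzγ⟩
  have hcont : ContinuousOn f (Icc xlo z) := by
    refine ContinuousOn.sub ?_ ((continuousOn_effective hb hγ hB hM hlo hS huniq hB' hM').mono hsub)
    refine ContinuousOn.div continuousOn_const (continuousOn_id.pow 2) fun x hx => ?_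
    exact pow_ne_zero 2 (hxlo0.trans_le hx.1).ne'
  -- intermediate values: f z ≤ 1/z² ≤ f x_lo
  have hfz : f z ≤ 1 / z ^ 2 := by
    have := hlo' _ (hS z hz hzγ).1
    show 1 / z ^ 2 - B' (S z) ≤ 1 / z ^ 2
    linarith
  have hfx : 1 / z ^ 2 ≤ f xlo := by
    have := hUge _ (hS xlo hxlo0 (hxloz.trans hzγ)).1
    show 1 / z ^ 2 ≤ 1 / xlo ^ 2 - B' (S xlo)
    rw [hxlo2]; linarith
  obtain ⟨x, hx, hfxeq⟩ := intermediate_value_Icc' hxloz hcont ⟨hfz, hfx⟩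
  refine ⟨x, hxlo0.trans_le hx.1, hx.2, ?_⟩
  have : 1 / x ^ 2 - B' (S x) = 1 / z ^ 2 := hfxeq
  linarith

/-- **THE ACCELERATED FLOW EXISTS FROM EVERY PIN**: for `y ∈ ]0,γ]` there is a box sequence `k` with `k_0 = y` and `1∕k_{m+1}² = 1∕k_m² + B′(S k_{m+1})`
for every `m` — the `B′`-flow whose memory term is read along the base family `S`, i.e. the flow of the MARKOV functional `u ↦ B′(S u_0)`; iterate §2's
one-step solution. [folklore] -/
theorem exists_accelerated (hb : 0 < b) (hγ : 0 < γ)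
    (hB : ∀ u u' : ℕ → ℝ, SeqBox γ u → SeqBox γ u' → ∀ D : ℝ, (∀ j, |u j - u' j| ≤ D) → |B u - B u'| ≤ M * D)
    (hM : 0 ≤ M) (hlo : ∀ u, SeqBox γ u → b ≤ B u)
    (hS : ∀ p, 0 < p → p ≤ γ → SeqBox γ (S p) ∧ MemFlow B p (S p))
    (huniq : ∀ p, 0 < p → p ≤ γ → ∀ u u' : ℕ → ℝ, SeqBox γ u → SeqBox γ u' → MemFlow B p u → MemFlow B p u' → u = u')
    (hB' : ∀ u u' : ℕ → ℝ, SeqBox γ u → SeqBox γ u' → ∀ D : ℝ, (∀ j, |u j - u' j| ≤ D) → |B' u - B' u'| ≤ M' * D) (hM' : 0 ≤ M')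
    (hlo' : ∀ u, SeqBox γ u → b ≤ B' u) (hy : 0 < y) (hyγ : y ≤ γ) :
    ∃ k : ℕ → ℝ, SeqBox γ k ∧ k 0 = y ∧ ∀ m, 1 / k (m + 1) ^ 2 = 1 / k m ^ 2 + B' (S (k (m + 1))) := by
  have hstep : ∀ z : ℝ, 0 < z → z ≤ γ → ∃ x : ℝ, (0 < x ∧ x ≤ γ) ∧ 1 / x ^ 2 = 1 / z ^ 2 + B' (S x) := by
    intro z hz hzγ
    obtain ⟨x, hx0, hxz, hxe⟩ := exists_accelerated_step hb hγ hB hM hlo hS huniq hB' hM' hlo' hz hzγ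
    exact ⟨x, ⟨hx0, hxz.trans hzγ⟩, hxe⟩
  choose! g hgbox hgeq using hstep
  refine ⟨fun m => g^[m] y, ?_, Function.iterate_zero_apply g y, ?_⟩
  · have hmem : ∀ m, 0 < g^[m] y ∧ g^[m] y ≤ γ := by
      intro m
      induction m with
      | zero => simpa using And.intro hy hyγ
      | succ m ih => rw [Function.iterate_succ_apply']; exact hgbox _ ih.1 ih.2
    exact fun m => hmem m
  · intro m
    have hmem : ∀ m, 0 < g^[m] y ∧ g^[m] y ≤ γ := by
      intro m
      induction m with
      | zero => simpa using And.intro hy hyγ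
      | succ m ih => rw [Function.iterate_succ_apply']; exact hgbox _ ih.1 ih.2
    show 1 / (g^[m + 1] y) ^ 2 = 1 / (g^[m] y) ^ 2 + B' (S (g^[m + 1] y))
    rw [Function.iterate_succ_apply']
    exact hgeq _ (hmem m).1 (hmem m).2

/-! ## §3 Sub-solutions lie above super-solutions: the accelerated flow is the highest barrier -/

/-- **SUB-SOLUTIONS LIE ABOVE SUPER-SOLUTIONS.**  `B` with zeroth moment `M ≥ 0` and floor `b > 0` on ]0,γ] with a unique solution family `S`, `B′`
ISOTONE; `u` a box SUB-solution of the `B′`-flow driven along `S` (`1∕u_{m+1}² ≤ 1∕u_m² + B′(S u_{m+1})`) and `k` a box SUPER-solution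
(`1∕k_m² + B′(S k_{m+1}) ≤ 1∕k_{m+1}²`) with `k_0 ≤ u_0`.  Then `k ≤ u` at EVERY scale — the induction of (E61a) `barrier_le` (there `u = S′ y`). [folklore] -/
theorem super_le_sub
    (hmono' : ∀ u v : ℕ → ℝ, SeqBox γ u → SeqBox γ v → (∀ j, u j ≤ v j) → B' u ≤ B' v) (hγ : 0 < γ) (hb : 0 < b)
    (hB : ∀ u u' : ℕ → ℝ, SeqBox γ u → SeqBox γ u' → ∀ D : ℝ, (∀ j, |u j - u' j| ≤ D) → |B u - B u'| ≤ M * D)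
    (hM : 0 ≤ M) (hlo : ∀ u, SeqBox γ u → b ≤ B u)
    (hS : ∀ p, 0 < p → p ≤ γ → SeqBox γ (S p) ∧ MemFlow B p (S p))
    (huniq : ∀ p, 0 < p → p ≤ γ → ∀ u u' : ℕ → ℝ, SeqBox γ u → SeqBox γ u' → MemFlow B p u → MemFlow B p u' → u = u')
    {u k : ℕ → ℝ} (hu : SeqBox γ u) (hsub : ∀ m, 1 / u (m + 1) ^ 2 ≤ 1 / u m ^ 2 + B' (S (u (m + 1))))
    (hk : SeqBox γ k) (hsuper : ∀ m, 1 / k m ^ 2 + B' (S (k (m + 1))) ≤ 1 / k (m + 1) ^ 2) (h0 : k 0 ≤ u 0) :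
    ∀ m, k m ≤ u m
  | 0 => h0
  | m + 1 => by
    have ih := super_le_sub hmono' hγ hb hB hM hlo hS huniq hu hsub hk hsuper h0 m
    by_contra hlt
    rw [not_le] at hlt
    have hz : u (m + 1) ∈ Ioc (0 : ℝ) γ := ⟨(hu (m + 1)).1, (hu (m + 1)).2⟩
    have hkm : k (m + 1) ∈ Ioc (0 : ℝ) γ := ⟨(hk (m + 1)).1, (hk (m + 1)).2⟩
    have h2 : B' (S (u (m + 1))) ≤ B' (S (k (m + 1))) :=
      hmono' _ _ (hS _ hz.1 hz.2).1 (hS _ hkm.1 hkm.2).1 fun j =>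
        (strictMonoOn_scale hb hγ hB hM hlo hS huniq j).monotoneOn hz hkm hlt.le
    have h3 : 1 / u m ^ 2 ≤ 1 / k m ^ 2 :=
      one_div_le_one_div_of_le (pow_pos (hk m).1 2) (pow_le_pow_left₀ (hk m).1.le ih 2)
    have h4 : 1 / u (m + 1) ^ 2 ≤ 1 / k (m + 1) ^ 2 := by linarith [hsub m, hsuper m]
    exact absurd (le_of_invSq_le hz.1 h4) (not_le.mpr hlt)

/-- **THE ACCELERATED FLOW IS THE HIGHEST BARRIER**: every barrier `k` from `y` (box super-solution, `k_0 = y`) lies below every accelerated flow `k⋆`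
from `y` (equality) at every scale. [folklore] -/
theorem barrier_le_accelerated
    (hmono' : ∀ u v : ℕ → ℝ, SeqBox γ u → SeqBox γ v → (∀ j, u j ≤ v j) → B' u ≤ B' v) (hγ : 0 < γ) (hb : 0 < b)
    (hB : ∀ u u' : ℕ → ℝ, SeqBox γ u → SeqBox γ u' → ∀ D : ℝ, (∀ j, |u j - u' j| ≤ D) → |B u - B u'| ≤ M * D)
    (hM : 0 ≤ M) (hlo : ∀ u, SeqBox γ u → b ≤ B u)
    (hS : ∀ p, 0 < p → p ≤ γ → SeqBox γ (S p) ∧ MemFlow B p (S p))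
    (huniq : ∀ p, 0 < p → p ≤ γ → ∀ u u' : ℕ → ℝ, SeqBox γ u → SeqBox γ u' → MemFlow B p u → MemFlow B p u' → u = u')
    {kstar k : ℕ → ℝ} (hkstar : SeqBox γ kstar) (hkstar0 : kstar 0 = y)
    (heq : ∀ m, 1 / kstar (m + 1) ^ 2 = 1 / kstar m ^ 2 + B' (S (kstar (m + 1))))
    (hk : SeqBox γ k) (hk0 : k 0 = y) (hsuper : ∀ m, 1 / k m ^ 2 + B' (S (k (m + 1))) ≤ 1 / k (m + 1) ^ 2) :
    ∀ m, k m ≤ kstar m :=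
  super_le_sub hmono' hγ hb hB hM hlo hS huniq hkstar (fun m => (heq m).le) hk hsuper (by rw [hk0, hkstar0])

/-- **THE ACCELERATED PAYOFF IS THE WEAKEST BARRIER PAYOFF**: if SOME barrier `k` from `y` has `B(S y) ≤ B′ k`, then so has every accelerated flow
`k⋆` from `y` (`B′ k ≤ B′ k⋆` by §3 and the isotonicity of `B′`). [folklore] -/
theorem payoff_accelerated_of_barrier
    (hmono' : ∀ u v : ℕ → ℝ, SeqBox γ u → SeqBox γ v → (∀ j, u j ≤ v j) → B' u ≤ B' v) (hγ : 0 < γ) (hb : 0 < b)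
    (hB : ∀ u u' : ℕ → ℝ, SeqBox γ u → SeqBox γ u' → ∀ D : ℝ, (∀ j, |u j - u' j| ≤ D) → |B u - B u'| ≤ M * D)
    (hM : 0 ≤ M) (hlo : ∀ u, SeqBox γ u → b ≤ B u)
    (hS : ∀ p, 0 < p → p ≤ γ → SeqBox γ (S p) ∧ MemFlow B p (S p))
    (huniq : ∀ p, 0 < p → p ≤ γ → ∀ u u' : ℕ → ℝ, SeqBox γ u → SeqBox γ u' → MemFlow B p u → MemFlow B p u' → u = u')
    {kstar k : ℕ → ℝ} (hkstar : SeqBox γ kstar) (hkstar0 : kstar 0 = y)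
    (heq : ∀ m, 1 / kstar (m + 1) ^ 2 = 1 / kstar m ^ 2 + B' (S (kstar (m + 1))))
    (hk : SeqBox γ k) (hk0 : k 0 = y) (hsuper : ∀ m, 1 / k m ^ 2 + B' (S (k (m + 1))) ≤ 1 / k (m + 1) ^ 2)
    (hpay : B (S y) ≤ B' k) : B (S y) ≤ B' kstar :=
  hpay.trans (hmono' k kstar hk hkstar (barrier_le_accelerated hmono' hγ hb hB hM hlo hS huniq hkstar hkstar0 heq hk hk0 hsuper))

/-! ## §4 THE BARRIER PRINCIPLE IN CANONICAL FORM -/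

/-- **THE STEP FROM THE ACCELERATED FLOW.**  Data as in (E61a) `effective_le_all_of_barrier` (`B` with zeroth moment `M ≥ 0` and floor `b > 0` on
]0,γ]; `B ≤ B′` with ISOTONE excess; `B′` ISOTONE with zeroth moment `M′ ≥ 0` and floor `b′ > 0`; unique solution families `S`, `S′`).  Suppose that for
every pin `y ∈ ]0,γ]` and every ACCELERATED FLOW `k` from `y` (box, `k_0 = y`, `1∕k_{m+1}² = 1∕k_m² + B′(S k_{m+1})`) the payoff `B(S y) ≤ B′ k` holds.
Then the effective β-functions are ordered at EVERY pin, `B(S y) ≤ B′(S′ y)` — hence (by (E49k) `family_le_of_orbit`) `S′ y ≤ S y` at every scale from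
every pin.  (§2 supplies an accelerated flow from every pin; it is a barrier; (E61a).)  By §3 this hypothesis is the weakest among all barrier payoffs:
THE STEP for the pair of implicit flows is reduced to ONE explicit recursion driven by the base family. [folklore] -/
theorem effective_le_all_of_accelerated {b' : ℝ}
    (hmono' : ∀ u v : ℕ → ℝ, SeqBox γ u → SeqBox γ v → (∀ j, u j ≤ v j) → B' u ≤ B' v)
    (hB : ∀ u u' : ℕ → ℝ, SeqBox γ u → SeqBox γ u' → ∀ D : ℝ, (∀ j, |u j - u' j| ≤ D) → |B u - B u'| ≤ M * D)
    (hM : 0 ≤ M) (hγ : 0 < γ) (hb : 0 < b) (hlo : ∀ u, SeqBox γ u → b ≤ B u) (hexc : ∀ u, SeqBox γ u → B u ≤ B' u)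
    (hDmono : ∀ u v : ℕ → ℝ, SeqBox γ u → SeqBox γ v → (∀ j, u j ≤ v j) → B' u - B u ≤ B' v - B v)
    (hb' : 0 < b') (hB' : ∀ u u' : ℕ → ℝ, SeqBox γ u → SeqBox γ u' → ∀ D : ℝ, (∀ j, |u j - u' j| ≤ D) → |B' u - B' u'| ≤ M' * D)
    (hM' : 0 ≤ M') (hlo' : ∀ u, SeqBox γ u → b' ≤ B' u)
    (hS : ∀ p, 0 < p → p ≤ γ → SeqBox γ (S p) ∧ MemFlow B p (S p))
    (huniq : ∀ p, 0 < p → p ≤ γ → ∀ u u' : ℕ → ℝ, SeqBox γ u → SeqBox γ u' → MemFlow B p u → MemFlow B p u' → u = u')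
    (hS' : ∀ p, 0 < p → p ≤ γ → SeqBox γ (S' p) ∧ MemFlow B' p (S' p))
    (huniq' : ∀ p, 0 < p → p ≤ γ → ∀ u u' : ℕ → ℝ, SeqBox γ u → SeqBox γ u' → MemFlow B' p u → MemFlow B' p u' → u = u')
    (hpay : ∀ y, 0 < y → y ≤ γ → ∀ k : ℕ → ℝ, SeqBox γ k → k 0 = y →
      (∀ m, 1 / k (m + 1) ^ 2 = 1 / k m ^ 2 + B' (S (k (m + 1)))) → B (S y) ≤ B' k) :
    ∀ y, 0 < y → y ≤ γ → B (S y) ≤ B' (S' y) := by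
  have hlo'' : ∀ u, SeqBox γ u → b ≤ B' u := fun u hu => (hlo u hu).trans (hexc u hu)
  refine effective_le_all_of_barrier hmono' hB hM hγ hb hlo hexc hDmono hb' hB' hM' hlo' hS huniq hS' huniq' fun y hy hyγ => ?_
  obtain ⟨k, hk, hk0, heq⟩ := exists_accelerated hb hγ hB hM hlo hS huniq hB' hM' hlo'' hy hyγ
  exact ⟨k, hk, hk0, fun m => by rw [heq m], hpay y hy hyγ k hk hk0 heq⟩

end Summit.QuantumFields.BalabanUV.Beta.EriceRemainderEnclosureHistoryAutonomyComparisonBarrierFlow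

end
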